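/-
Origin: expansion seat `prover-pub-hodgecm-mc-binder-1-g12-0`, handover #64 2026-08-20T12:37:02Z md5 4414f5e5d27d (NEW additive KERNEL leaf; imports #60 + HypCensus/ArchDatumBlockCM + vendored; drop-alone) (`HOME/mc/pub-hodgecm-mc-binder-1-g12/stage51/HodgeCM/Model/Binders/Real34FrameMatch.lean`, md5 4414f5e5d27d, 107 lines);
landed by the gen-20 packager (p-g20) in gate run 51 as `HodgeCM/Model/Binders/Real34FrameMatch.lean` (verbatim).
-/
/-
Origin: pub-hodgecm MODEL-CONSTRUCTION sub-cell (Hodge conjecture, CM-per-L package), seat mc-binder-1 gen 12, session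
prover-pub-hodgecm-mc-binder-1-g12-0, 2026-08-20.  Target in PKG: HodgeCM/Model/Binders/Real34FrameMatch.lean (NEW additive leaf; imports RUN-50 #60
`Binders/Real34ScaledFrameSum` + binder-2's `HypCensus/ArchDatumBlockCM` + vendored `Automorphic/UnitaryGroupDirectSumCarriers`, `GelbartRogawski1991/UnitaryDualPairSeesawCMLines`).  KERNEL MATHEMATICS ONLY.
Consumer: `harch` of the row-17 socket (#55/#56), HARCH-PLAN.md §7 (3): the two scaled frames of `Fin 3 × Fin 2` in which the census side and the line side
of (A″) land — through #55's reindexings `R_{finProdFinEquiv}⁻¹` and `R_{(finProdSumEquiv 3 1 1)⁻¹} ∘ ⊠ ∘ (R_{e₁⁻¹} × R_{e₁⁻¹})` — are THE SAME frame.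
-/
import Summits.HodgeConjecture.HodgeCM.Model.Binders.Real34ScaledFrameSum
import Summits.HodgeConjecture.HodgeCM.Model.HypCensus.ArchDatumBlockCM
import Literature.NumberTheory.Automorphic.UnitaryGroupDirectSumCarriers
import Literature.NumberTheory.GelbartRogawski1991.UnitaryDualPairSeesawCMLines

/-!
# Row 17 (`real34`): the census frame and the two-line frame agree on `Fin 3 × Fin 2`

#55 `exists_tau34_tmul` fixes `Tinf Φ₂ Φ₃ = R_{finProdFinEquiv} (A (R_{(finProdSumEquiv 3 1 1)⁻¹} (R_{e₁⁻¹} Φ₂ ⊠ R_{e₁⁻¹} Φ₃)))`, `e₁ = Equiv.prodUnique (Fin 3) (Fin 1)`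
(`ArchSideTerm.e₁`), so (A″) of HARCH-PLAN §6 compares, on the index type `κ = Fin 3 × Fin 2`,
`R_{finProdFinEquiv}⁻¹ (S_∞ X₀)` — a Folland letter of `scaledFrame κ (reindexScale finProdFinEquiv⁻¹ (pairScale 3 2 DV DW′))` (#59/#63 + #60) — with
`R_{(finProdSumEquiv 3 1 1)⁻¹} (Z₂ e_a ⊠ Z₃ e_b − …)` — a Folland letter of `scaledFrame κ (reindexScale (finProdSumEquiv 3 1 1)⁻¹ (sumScale (reindexScale e₁⁻¹ (pairScale 3 1 DV DW₂))
(reindexScale e₁⁻¹ (pairScale 3 1 DV DW₃))))` (carch's `blockFamilyOfAt_degOnePDual_binvPi_one` + #60).  This file proves the two scaling vectors are EQUAL: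

* **`reindexScale_pairScale_two_eq_lines`** (generic: `DV`, a joint `DW′ : places → Fin 2 → ℝ` and line scalings `DWl j : places → Fin 1 → ℝ` with `DWl j v 0 = DW′ v j`);
* `cmDW_lineVec` (`cmDW L dV (lineVec (d j)) _ ι₁ v 0 = cmDW L dV d hd ι₁ v j`, `rfl`) and the instance **`census_frame_eq_lines_frame`** for
  `DV = cmDV L dV hdV ι₁`, `DW′ = cmDW L dV dW' hdW' ι₁`, `DWl j = cmDW L dV (lineVec (dW' j)) _ ι₁`.

So after #63 both sides of (A″) are `follandFock` of ONE `scaledFrame κ D hD` (use #63 `follandFock_scaledFrame_congr` to align the proofs) and (A″) is an identity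
of polynomials in `MvPolynomial (κ × places) ℂ` (HARCH-PLAN §7 (4)).

## References
* [Folland1989] G. B. Folland, *Harmonic Analysis in Phase Space*, Princeton UP (1989), §1.7.
-/

set_option autoImplicit false

noncomputable section

open NumberField NumberField.InfinitePlace NumberField.mixedEmbedding
open Literature.NumberTheory.Weil1964 Literature.NumberTheory.Automorphic Literature.NumberTheory.Automorphic.UnitaryGroup
open Literature.NumberTheory.GelbartRogawski1991.UnitaryDualPair

namespace HodgeCM.Model

/-! ## §1 Generic: the joint `Fin 3 × Fin 2` scalings vs the two lines' scalings -/

section Generic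

variable {F : Type} [Field F] {N : ℕ}

/-- `finProdSumEquiv N 1 1 (i, 0) = inl (i, 0)`. [folklore] -/
theorem finProdSumEquiv_zero (i : Fin N) : finProdSumEquiv N 1 1 (i, 0) = Sum.inl (i, 0) := by
  have h0 : (finSumFinEquiv (m := 1) (n := 1)).symm 0 = Sum.inl (0 : Fin 1) := by decide
  simp [finProdSumEquiv, h0]

/-- `finProdSumEquiv N 1 1 (i, 1) = inr (i, 0)`. [folklore] -/
theorem finProdSumEquiv_one (i : Fin N) : finProdSumEquiv N 1 1 (i, 1) = Sum.inr (i, 0) := by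
  have h1 : (finSumFinEquiv (m := 1) (n := 1)).symm 1 = Sum.inr (0 : Fin 1) := by decide
  simp [finProdSumEquiv, h1]

/-- **The census scalings on `Fin N × Fin 2` are the two lines' scalings**: for a joint `W`-scaling `DW′` and line scalings `DWl j` with `DWl j v 0 = DW′ v j`,
`reindexScale finProdFinEquiv⁻¹ (pairScale N 2 DV DW′) = reindexScale (finProdSumEquiv N 1 1)⁻¹ (sumScale (reindexScale e₁⁻¹ (pairScale N 1 DV (DWl 0)))
(reindexScale e₁⁻¹ (pairScale N 1 DV (DWl 1))))`, `e₁ = Equiv.prodUnique (Fin N) (Fin 1)`. [folklore] -/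
theorem reindexScale_pairScale_two_eq_lines {n : ℕ} (eW : Fin N × Fin 2 ≃ Fin n)
    (DV : {v : InfinitePlace F // v.IsReal} → Fin N → ℝ) (DW' : {v : InfinitePlace F // v.IsReal} → Fin 2 → ℝ)
    (DWl : Fin 2 → {v : InfinitePlace F // v.IsReal} → Fin 1 → ℝ) (h : ∀ j v, DWl j v 0 = DW' v j) :
    reindexScale eW.symm (pairScale N 2 (e := eW) DV DW') =
      reindexScale (finProdSumEquiv N 1 1).symm
        (sumScale (reindexScale (Equiv.prodUnique (Fin N) (Fin 1)).symm (pairScale N 1 (e := Equiv.prodUnique (Fin N) (Fin 1)) DV (DWl 0)))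
          (reindexScale (Equiv.prodUnique (Fin N) (Fin 1)).symm (pairScale N 1 (e := Equiv.prodUnique (Fin N) (Fin 1)) DV (DWl 1)))) := by
  funext k
  obtain ⟨⟨i, j⟩, v⟩ := k
  fin_cases j
  · simp [reindexScale_apply, pairScale, finProdSumEquiv_zero, h]
  · simp [reindexScale_apply, pairScale, finProdSumEquiv_one, h]

end Generic

/-! ## §2 The instance: canonical CM scalings of the see-saw pin `diag(dW')` and of its two lines -/

section CM

open HodgeCM.Model.HypCensus

variable (L : Type) [Field L] [NumberField L] [IsCMField L] {N : ℕ}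
variable (dV : Fin N → L) (hdV : ∀ i, IsCMField.complexConj L (dV i) = dV i) (ι₁ : L →+* ℂ)
variable (dW' : Fin 2 → L) (hdW' : ∀ i, IsCMField.complexConj L (dW' i) = dW' i)

/-- The canonical `W`-scaling of the line `lineVec (d j)` is the `j`-th canonical `W`-scaling of `d` (`rfl`). [folklore] -/
theorem cmDW_lineVec (v : {v : InfinitePlace ↥(maximalRealSubfield L) // v.IsReal}) (j : Fin 2) :
    cmDW L dV (lineVec L (dW' j)) (fun _ => hdW' j) ι₁ v 0 = cmDW L dV dW' hdW' ι₁ v j := rfl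

/-- **The census frame (see-saw pin `diag(dW')` on `Fin N × Fin 2`) IS the two-line frame**:
`reindexScale eW⁻¹ (pairScale N 2 cmDV (cmDW dW')) = reindexScale (finProdSumEquiv N 1 1)⁻¹ (sumScale (line 0) (line 1))`. [folklore] -/
theorem census_frame_eq_lines_frame {n : ℕ} (eW : Fin N × Fin 2 ≃ Fin n) :
    reindexScale eW.symm (pairScale N 2 (e := eW) (cmDV L dV hdV ι₁) (cmDW L dV dW' hdW' ι₁)) =
      reindexScale (finProdSumEquiv N 1 1).symm
        (sumScale
          (reindexScale (Equiv.prodUnique (Fin N) (Fin 1)).symm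
            (pairScale N 1 (e := Equiv.prodUnique (Fin N) (Fin 1)) (cmDV L dV hdV ι₁) (cmDW L dV (lineVec L (dW' 0)) (fun _ => hdW' 0) ι₁)))
          (reindexScale (Equiv.prodUnique (Fin N) (Fin 1)).symm
            (pairScale N 1 (e := Equiv.prodUnique (Fin N) (Fin 1)) (cmDV L dV hdV ι₁) (cmDW L dV (lineVec L (dW' 1)) (fun _ => hdW' 1) ι₁)))) :=
  reindexScale_pairScale_two_eq_lines eW _ _ (fun j => cmDW L dV (lineVec L (dW' j)) (fun _ => hdW' j) ι₁) fun _ _ => rfl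

end CM

end HodgeCM.Model

end
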